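import Literature.Analysis.FluidPDE.OnsagerBDSVGluedEnergy
import Literature.Analysis.FluidPDE.OnsagerBDSVAntidivCurl
import Literature.Analysis.FluidPDE.OnsagerBDSVBiotSavart
import Literature.Analysis.FluidPDE.OnsagerBDSVPotentialTheoryProofs
import Literature.Analysis.FunctionSpaces.ContDiffHolderLeibniz
import HarnessLib

/-!
# The BDSV gluing stage: Prop. 4.3, (4.7) — the bound (2.20) on the glued Reynolds stress

Buckmaster–De Lellis–Székelyhidi–Vicol, *Onsager's conjecture for admissible weak solutions*,
CPAM 72 (2019) = arXiv:1701.08678, §4.4, Prop. 4.3, first estimate (4.7) = (2.20):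
"`‖R̊̄_q‖_{N+α} ≲ δ_{q+1} ℓ^{-N+α}`", proved from
`R̊̄_q = ∂ₜχᵢ (ℛ curl)(zᵢ - zᵢ₊₁) - χᵢ(1-χᵢ)(vᵢ - vᵢ₊₁) ⊗̊ (vᵢ - vᵢ₊₁)` on `Iᵢ` ("Recall that
`vᵢ = curl zᵢ`"), "`ℛ curl` is a zero-order operator" (App. C), Prop. 3.4 (3.17) and (3.12):
"`‖R̊̄_q‖_{N+α} ≲ τ_q⁻¹ ‖zᵢ - zᵢ₊₁‖_{N+α} + ‖vᵢ - vᵢ₊₁‖_{N+α} ‖vᵢ - vᵢ₊₁‖_α ≲ δ_{q+1} ℓ^{-N+α} + τ_q² δ_{q+1}² ℓ^{-2-N+2α} ≲ δ_{q+1} ℓ^{-N+α}`.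
Here we used again (4.6)."

For the glued stress `BDSV.gluedStress` of a `BDSV.IsGlueFamily` (`OnsagerBDSVGluedTriple.lean`)
whose members obey the §3 bounds `BDSV.StabilityBounds` / `BDSV.PotentialBounds` (constant `C₃`,
orders `≤ N̄`) this file proves, with explicit constants:

* `BDSV.exists_tracelessCLM`, `BDSV.eContDiffHolderNorm_tracelessSq_le` — the traceless square
  `w ⊗̊ w` is a fixed continuous bilinear map `B` of the values, whence the Leibniz bound
  `‖w ⊗̊ w‖_{N,r} ≤ 3ᴺ‖B‖ ∑ⱼ ‖w‖_{j,r} ‖w‖_{N-j,r}`;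
* `BDSV.glueScale_sq_mul_amp_succ_sq_mul_rpow_le` — the parameter conversion
  `τ_q² δ_{q+1}² ℓ^{-N-2+2α} ≤ δ_{q+1} ℓ^{-N+α}` ((4.6) squared and `ℓ ≤ 1`);
* `BDSV.IsGlueFamily.curl_biotSavart_velDiff` — `wᵢ = curl ℬwᵢ` for `wᵢ = vᵢ - vᵢ₊₁` on
  `[tᵢ, tᵢ + τ_q]` (divergence free with zero mean, by conservation of momentum);
* `BDSV.IsGlueFamily.eContDiffHolderNorm_velDiff_le` ((3.12) for `wᵢ`),
  `….eContDiffHolderNorm_biotSavart_velDiff_le` ((3.17)),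
  `….eContDiffHolderNorm_antidivergence_velDiff_le` (`‖ℛwᵢ‖_{N+α} ≤ C_cz|C₃|τ_qδ_{q+1}ℓ^{-N+α}`,
  given a Calderón–Zygmund constant `C_cz` for `ℛ ∘ curl`, cf.
  `BDSV.holderCZBound.antidivergence_curl_le` and the proved `BDSV.holderCZBound_holds`),
  `….eContDiffHolderNorm_tracelessSq_velDiff_le` (the transition term);
* `BDSV.IsGlueFamily.eContDiffHolderNorm_gluedStress_le`, `….holderSupLE_gluedStress` —
  **(2.20)**: `‖R̊̄_q(t)‖_{N+α} ≤ (E₁C_cz|C₃| + 3ᴺ‖B‖(N+1)4C₃²) δ_{q+1} ℓ^{-N+α}` on `[0,T]` for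
  `N ≤ N̄` (`E₁ = BDSV.stepProfileBound 1`, the bound (4.3) on `∂ₜχᵢ`).

## References

* T. Buckmaster, C. De Lellis, L. Székelyhidi Jr., V. Vicol, *Onsager's conjecture for admissible
  weak solutions*, Comm. Pure Appl. Math. 72 (2019) 229–274 = arXiv:1701.08678, §4.4 (Prop. 4.3,
  (4.7)), §4.3 (4.6), §3 (3.12), (3.17), §2.5 (2.20).
-/

noncomputable section

open MeasureTheory Set Filter Topology Function
open scoped NNReal ENNReal ContDiff

namespace Literature.Analysis.FluidPDE

namespace BDSV

open FunctionSpaces FunctionSpaces.Torus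

/-! ## The traceless square as a continuous bilinear map -/

section TracelessBilinear

/-- **The traceless tensor square is a continuous bilinear map of the values**: there is a
continuous bilinear `B : ℝ³ × ℝ³ → (Fin 3 → ℝ³)` with `B(a,b)ⱼ = aⱼ b - (⟪a,b⟫/3) eⱼ`, so that
`(w ⊗̊ w)(y) = B(w(y), w(y))` (finite dimension). [folklore] -/
theorem exists_tracelessCLM : ∃ B : EuclideanSpace ℝ (Fin 3) →L[ℝ] EuclideanSpace ℝ (Fin 3) →L[ℝ] (Fin 3 → EuclideanSpace ℝ (Fin 3)),
    ∀ (a b : EuclideanSpace ℝ (Fin 3)) (j : Fin 3), B a b j = a j • b - (inner ℝ a b / 3) • EuclideanSpace.single j (1 : ℝ) := by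
  let L₀ : EuclideanSpace ℝ (Fin 3) →ₗ[ℝ] EuclideanSpace ℝ (Fin 3) →ₗ[ℝ] (Fin 3 → EuclideanSpace ℝ (Fin 3)) := LinearMap.mk₂ ℝ
    (fun a b j => a j • b - (inner ℝ a b / 3) • EuclideanSpace.single j (1 : ℝ))
    (fun a a' b => by
      funext j
      simp only [PiLp.add_apply, inner_add_left, Pi.add_apply]
      rw [add_smul, add_div, add_smul]
      abel)
    (fun c a b => by
      funext j
      simp only [PiLp.smul_apply, smul_eq_mul, inner_smul_left, Pi.smul_apply, RCLike.conj_to_real]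
      rw [smul_sub, mul_smul, mul_div_assoc, mul_smul])
    (fun a b b' => by
      funext j
      simp only [inner_add_right, Pi.add_apply]
      rw [smul_add, add_div, add_smul]
      abel)
    (fun c a b => by
      funext j
      simp only [inner_smul_right, Pi.smul_apply]
      rw [smul_sub, smul_comm (a j) c b, mul_div_assoc, mul_smul])
  let L₁ : EuclideanSpace ℝ (Fin 3) →ₗ[ℝ] EuclideanSpace ℝ (Fin 3) →L[ℝ] (Fin 3 → EuclideanSpace ℝ (Fin 3)) :=
    (LinearMap.toContinuousLinearMap : (EuclideanSpace ℝ (Fin 3) →ₗ[ℝ] (Fin 3 → EuclideanSpace ℝ (Fin 3))) ≃ₗ[ℝ] (EuclideanSpace ℝ (Fin 3) →L[ℝ] (Fin 3 → EuclideanSpace ℝ (Fin 3)))).toLinearMap.comp L₀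
  refine ⟨LinearMap.toContinuousLinearMap L₁, fun a b j => ?_⟩
  simp [L₁, L₀]

variable {B : EuclideanSpace ℝ (Fin 3) →L[ℝ] EuclideanSpace ℝ (Fin 3) →L[ℝ] (Fin 3 → EuclideanSpace ℝ (Fin 3))}
  (hB : ∀ (a b : EuclideanSpace ℝ (Fin 3)) (j : Fin 3), B a b j = a j • b - (inner ℝ a b / 3) • EuclideanSpace.single j (1 : ℝ))
include hB

/-- `(w ⊗̊ w)(y) = B(w(y), w(y))`. [folklore] -/
theorem tracelessSq_eq_bilinear (w : UnitAddTorus (Fin 3) → EuclideanSpace ℝ (Fin 3)) (y : UnitAddTorus (Fin 3)) : Torus.tracelessSq w y = B (w y) (w y) := by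
  funext j
  rw [hB, real_inner_self_eq_norm_sq]
  simp [Torus.tracelessSq]

/-- `w ⊗̊ w = (y ↦ B(w(y), w(y)))` as functions. [folklore] -/
theorem tracelessSq_eq_bilinear_fun (w : UnitAddTorus (Fin 3) → EuclideanSpace ℝ (Fin 3)) : Torus.tracelessSq w = fun y => B (w y) (w y) :=
  funext fun y => tracelessSq_eq_bilinear hB w y

/-- **Leibniz bound for the traceless square**: `‖w ⊗̊ w‖_{N,r} ≤ 3ᴺ ‖B‖ ∑_{j ≤ N} ‖w‖_{j,r} ‖w‖_{N-j,r}`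
for smooth `w` (BDSV §4.4: "`‖vᵢ - vᵢ₊₁‖_{N+α} ‖vᵢ - vᵢ₊₁‖_α`", up to the Leibniz sum). [cite: BuckmasterEtAl2018, §4.4 (proof of Prop. 4.3)] -/
theorem eContDiffHolderNorm_tracelessSq_le {w : UnitAddTorus (Fin 3) → EuclideanSpace ℝ (Fin 3)} (hw : IsSmooth w) (N : ℕ) (r : ℝ≥0) :
    Torus.eContDiffHolderNorm N r (Torus.tracelessSq w) ≤
      3 ^ N * ‖B‖ₑ * ∑ j ∈ Finset.range (N + 1),
        Torus.eContDiffHolderNorm j r w * Torus.eContDiffHolderNorm (N - j) r w := by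
  rw [tracelessSq_eq_bilinear_fun hB w]
  have hN : IsContDiff N w := hw.isContDiff (by exact_mod_cast le_top)
  exact Torus.eContDiffHolderNorm_bilinear_le B hN hN r

end TracelessBilinear

/-! ## Two more parameter inequalities -/

section Params

variable {β α a b : ℝ}

/-- (4.6) squared: `τ_q² δ_{q+1} ≤ ℓ²` (`a, b ≥ 1`, `β, α ≥ 0`). [cite: BuckmasterEtAl2018, §4.3 (4.6)] -/
theorem glueScale_sq_mul_amp_succ_le (ha : 1 ≤ a) (hb : 1 ≤ b) (hβ : 0 ≤ β) (hα : 0 ≤ α) (q : ℕ) :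
    glueScale β α a b q ^ 2 * amp β a b (q + 1) ≤ mollScale β α a b q ^ 2 := by
  have h := sqrt_amp_succ_mul_glueScale_le (β := β) (α := α) ha hb hβ hα q
  have hτ := (glueScale_pos (β := β) (α := α) (b := b) ha q).le
  have hδ := (amp_pos (β := β) (b := b) ha (q + 1)).le
  have h0 : 0 ≤ Real.sqrt (amp β a b (q + 1)) * glueScale β α a b q := by positivity
  have h2 := mul_le_mul h h h0 (mollScale_pos (β := β) (α := α) (b := b) ha q).le
  have hsq : Real.sqrt (amp β a b (q + 1)) ^ 2 = amp β a b (q + 1) := Real.sq_sqrt hδ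
  have e : (Real.sqrt (amp β a b (q + 1)) * glueScale β α a b q) * (Real.sqrt (amp β a b (q + 1)) * glueScale β α a b q) =
      glueScale β α a b q ^ 2 * amp β a b (q + 1) := by
    rw [show (Real.sqrt (amp β a b (q + 1)) * glueScale β α a b q) * (Real.sqrt (amp β a b (q + 1)) * glueScale β α a b q) =
      glueScale β α a b q ^ 2 * Real.sqrt (amp β a b (q + 1)) ^ 2 by ring, hsq]
  calc glueScale β α a b q ^ 2 * amp β a b (q + 1)
      = (Real.sqrt (amp β a b (q + 1)) * glueScale β α a b q) * (Real.sqrt (amp β a b (q + 1)) * glueScale β α a b q) := e.symm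
    _ ≤ mollScale β α a b q * mollScale β α a b q := h2
    _ = mollScale β α a b q ^ 2 := by ring

/-- **The conversion of the proof of Prop. 4.3**: `τ_q² δ_{q+1}² ℓ^{-N-2+2α} ≤ δ_{q+1} ℓ^{-N+α}`
(`τ²δ_{q+1} ≤ ℓ²` and `ℓ^α ≤ 1`), for `a, b ≥ 1`, `β, α ≥ 0`, real `N`. [cite: BuckmasterEtAl2018, §4.4 (proof of Prop. 4.3, "(e:calculation11)")] -/
theorem glueScale_sq_mul_amp_succ_sq_mul_rpow_le (ha : 1 ≤ a) (hb : 1 ≤ b) (hβ : 0 ≤ β) (hα : 0 ≤ α) (q : ℕ) (N : ℝ) :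
    glueScale β α a b q ^ 2 * amp β a b (q + 1) ^ 2 * mollScale β α a b q ^ (-N - 2 + 2 * α) ≤
      amp β a b (q + 1) * mollScale β α a b q ^ (-N + α) := by
  have hℓ := mollScale_pos (β := β) (α := α) (b := b) ha q
  have hℓ1 := mollScale_le_one (β := β) (α := α) ha hb hβ hα q
  have hδ := (amp_pos (β := β) (b := b) ha (q + 1)).le
  have h1 := glueScale_sq_mul_amp_succ_le (β := β) (α := α) ha hb hβ hα q
  have hℓ2 : mollScale β α a b q ^ 2 = mollScale β α a b q ^ (2 : ℝ) := by
    rw [← Real.rpow_natCast]; norm_num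
  -- `ℓ^{-N-2+2α} = ℓ^{-2} ℓ^{α} ℓ^{-N+α}`
  have e : mollScale β α a b q ^ (-N - 2 + 2 * α) =
      mollScale β α a b q ^ (-(2 : ℝ)) * mollScale β α a b q ^ α * mollScale β α a b q ^ (-N + α) := by
    rw [← Real.rpow_add hℓ, ← Real.rpow_add hℓ]; congr 1; ring
  have hℓα : mollScale β α a b q ^ α ≤ 1 := Real.rpow_le_one hℓ.le hℓ1 hα
  have hA : glueScale β α a b q ^ 2 * amp β a b (q + 1) * mollScale β α a b q ^ (-(2 : ℝ)) ≤ 1 := by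
    rw [Real.rpow_neg hℓ.le, ← hℓ2, mul_inv_le_iff₀ (pow_pos hℓ 2), one_mul]
    exact h1
  calc glueScale β α a b q ^ 2 * amp β a b (q + 1) ^ 2 * mollScale β α a b q ^ (-N - 2 + 2 * α)
      = (glueScale β α a b q ^ 2 * amp β a b (q + 1) * mollScale β α a b q ^ (-(2 : ℝ))) *
          mollScale β α a b q ^ α * (amp β a b (q + 1) * mollScale β α a b q ^ (-N + α)) := by
        rw [e]; ring
    _ ≤ 1 * 1 * (amp β a b (q + 1) * mollScale β α a b q ^ (-N + α)) := by
        gcongr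
    _ = amp β a b (q + 1) * mollScale β α a b q ^ (-N + α) := by ring

/-- `ℓ^{2α} ≤ ℓ^{α}` (`0 < ℓ ≤ 1`, `α ≥ 0`). [folklore] -/
theorem mollScale_rpow_two_mul_le_rpow (ha : 1 ≤ a) (hb : 1 ≤ b) (hβ : 0 ≤ β) (hα : 0 ≤ α) (q : ℕ) :
    mollScale β α a b q ^ (2 * α) ≤ mollScale β α a b q ^ α := by
  have hℓ := mollScale_pos (β := β) (α := α) (b := b) ha q
  have hℓ1 := mollScale_le_one (β := β) (α := α) ha hb hβ hα q
  exact Real.rpow_le_rpow_of_exponent_ge hℓ hℓ1 (by linarith)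

end Params

/-! ## Bounds on the steps and weights -/

section StepBounds

variable {τ : ℝ} {n k : ℕ}

/-- `|θ_k'(t)| ≤ E₁ τ⁻¹` (`E₁ = stepProfileBound 1`; zero for `k ≥ n`). [cite: BuckmasterEtAl2018, §4.1 (4.3)] -/
theorem abs_stepDeriv_le (hτ : 0 < τ) (n k : ℕ) (t : ℝ) : |stepDeriv τ n k t| ≤ stepProfileBound 1 * τ⁻¹ := by
  unfold stepDeriv
  by_cases hk : k < n
  · rw [show upperStep τ n k = glueStep τ (k * τ) from funext fun s => upperStep_of_lt hk τ s]
    exact abs_deriv_glueStep_le hτ _ t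
  · rw [show upperStep τ n k = fun _ => (1 : ℝ) from funext fun s => upperStep_of_le (not_lt.1 hk) τ s, deriv_const]
    simp only [abs_zero]
    exact mul_nonneg (stepProfileBound_nonneg 1) (inv_nonneg.2 hτ.le)

/-- `0 ≤ θ_k(1 - θ_k) ≤ 1`. [folklore] -/
theorem stepWeight_mem_Icc (τ : ℝ) (n k : ℕ) (t : ℝ) : stepWeight τ n k t ∈ Icc (0 : ℝ) 1 := by
  have h := upperStep_mem_Icc τ n k t
  unfold stepWeight
  constructor
  · exact mul_nonneg h.1 (by linarith [h.2])
  · nlinarith [h.1, h.2]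

/-- `|θ_k(1 - θ_k)| ≤ 1`. [folklore] -/
theorem abs_stepWeight_le_one (τ : ℝ) (n k : ℕ) (t : ℝ) : |stepWeight τ n k t| ≤ 1 := by
  have h := stepWeight_mem_Icc τ n k t
  rw [abs_of_nonneg h.1]
  exact h.2

end StepBounds

/-! ## The glued stress at a fixed time -/

section Stress

variable {β α a b T C₃ : ℝ} {q n Nb : ℕ} {vℓ : ℝ → UnitAddTorus (Fin 3) → EuclideanSpace ℝ (Fin 3)} {pℓ : ℝ → UnitAddTorus (Fin 3) → ℝ}
  {Rℓ : ℝ → UnitAddTorus (Fin 3) → Fin 3 → EuclideanSpace ℝ (Fin 3)} {v : ℕ → ℝ → UnitAddTorus (Fin 3) → EuclideanSpace ℝ (Fin 3)} {p : ℕ → ℝ → UnitAddTorus (Fin 3) → ℝ}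

/-- For `i < n` the common life span `Sᵢ ∩ Sᵢ₊₁` of two consecutive exact solutions is exactly
`[tᵢ, tᵢ + τ]`. [folklore] -/
theorem IsGlueFamily.glueInterval_inter_succ {τ : ℝ} (h : IsGlueFamily T τ n vℓ pℓ Rℓ v p) {i : ℕ} (hi : i < n) :
    glueInterval T τ i ∩ glueInterval T τ (i + 1) = Icc ((i : ℝ) * τ) ((i : ℝ) * τ + τ) := by
  refine Subset.antisymm ?_ fun t ht => ⟨(h.Icc_subset_glueInterval hi).1 ht, (h.Icc_subset_glueInterval hi).2 ht⟩
  rintro t ⟨⟨h1, -⟩, ⟨h2, -⟩⟩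
  rw [mem_Icc] at h1 h2
  push_cast at h2
  exact ⟨by linarith [h2.1], h1.2⟩

/-- `w_i = (v_i - v_ℓ) - (v_{i+1} - v_ℓ)`. [folklore] -/
theorem velDiff_eq_sub_sub (v : ℕ → ℝ → UnitAddTorus (Fin 3) → EuclideanSpace ℝ (Fin 3)) (vℓ : ℝ → UnitAddTorus (Fin 3) → EuclideanSpace ℝ (Fin 3)) (i : ℕ) (t : ℝ) :
    velDiff v i t = (fun x => v i t x - vℓ t x) - fun x => v (i + 1) t x - vℓ t x := by
  funext x
  simp [velDiff]

/-- The velocity difference `w_i(t)` is smooth at the times of `[tᵢ, tᵢ + τ]` (`i < n`). [folklore] -/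
theorem IsGlueFamily.isSmooth_velDiff {τ : ℝ} (h : IsGlueFamily T τ n vℓ pℓ Rℓ v p) {i : ℕ} (hi : i < n)
    {t : ℝ} (ht : t ∈ Icc ((i : ℝ) * τ) ((i : ℝ) * τ + τ)) : IsSmooth (velDiff v i t) :=
  (h.smooth_velDiff hi).isSmooth_slice ht

/-- The velocity difference `w_i(t)` is divergence free. [folklore] -/
theorem IsGlueFamily.isDivFree_velDiff {τ : ℝ} (h : IsGlueFamily T τ n vℓ pℓ Rℓ v p) {i : ℕ} (hi : i < n)
    {t : ℝ} (ht : t ∈ Icc ((i : ℝ) * τ) ((i : ℝ) * τ + τ)) : IsDivFree (velDiff v i t) := by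
  have hti : t ∈ glueInterval T τ i := (h.Icc_subset_glueInterval hi).1 ht
  have hti' : t ∈ glueInterval T τ (i + 1) := (h.Icc_subset_glueInterval hi).2 ht
  have hvA : IsSmooth (v i t) := h.isSmooth_v hi.le hti
  have hvB : IsSmooth (v (i + 1) t) := h.isSmooth_v (Nat.succ_le_of_lt hi) hti'
  have hdA : IsDivFree (v i t) := (h.exact i (h.anchor_le hi.le)).divFree t hti
  have hdB : IsDivFree (v (i + 1) t) := (h.exact (i + 1) (h.anchor_le (Nat.succ_le_of_lt hi))).divFree t hti'
  have e : velDiff v i t = fun x => (1 : ℝ) • v i t x + (-1 : ℝ) • v (i + 1) t x := by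
    funext x; simp [velDiff, sub_eq_add_neg]
  rw [e]
  exact IsDivFree.add ((hvA.smul _).isContDiff (by simp)) ((hvB.smul _).isContDiff (by simp))
    (Torus.isDivFree_const_smul (hvA.isContDiff (by simp)) hdA _) (Torus.isDivFree_const_smul (hvB.isContDiff (by simp)) hdB _)

/-- **`w_i = curl z_i`, `z_i = ℬ w_i`** at the times of `[tᵢ, tᵢ + τ]` (`i < n`): `w_i(t)` is
divergence free with zero mean (BDSV §4.4: "Recall that `vᵢ = curl zᵢ`"). [cite: BuckmasterEtAl2018, §4.4 (proof of Prop. 4.3)] -/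
theorem IsGlueFamily.curl_biotSavart_velDiff {τ : ℝ} (h : IsGlueFamily T τ n vℓ pℓ Rℓ v p) {i : ℕ} (hi : i < n)
    {t : ℝ} (ht : t ∈ Icc ((i : ℝ) * τ) ((i : ℝ) * τ + τ)) : curl (biotSavart (velDiff v i t)) = velDiff v i t :=
  curl_biotSavart_of_integral_eq_zero (h.isSmooth_velDiff hi ht) (h.isDivFree_velDiff hi ht) (h.integral_velDiff hi ht)

/-- **(3.12) for the difference**: `‖w_i(t)‖_{m+α} ≤ 2|C₃| τ_q δ_{q+1} ℓ^{-m-1+α}` on `[tᵢ, tᵢ + τ]`,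
`i < n`, `m ≤ N̄` (Prop. 3.3 for `vᵢ - v_ℓ` and `vᵢ₊₁ - v_ℓ`). [cite: BuckmasterEtAl2018, Prop. 3.4 (proof, (3.17))] -/
theorem IsGlueFamily.eContDiffHolderNorm_velDiff_le (h : IsGlueFamily T (glueScale β α a b q) n vℓ pℓ Rℓ v p)
    (hS : ∀ i : ℕ, i ≤ n → StabilityBounds β α a b T C₃ q Nb i vℓ pℓ (v i) (p i)) (ha : 1 ≤ a)
    {i : ℕ} (hi : i < n) {t : ℝ} (ht : t ∈ Icc ((i : ℝ) * glueScale β α a b q) ((i : ℝ) * glueScale β α a b q + glueScale β α a b q))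
    {m : ℕ} (hm : m ≤ Nb) :
    Torus.eContDiffHolderNorm m (Real.toNNReal α) (velDiff v i t) ≤
      ENNReal.ofReal (2 * |C₃| * (glueScale β α a b q * amp β a b (q + 1) * mollScale β α a b q ^ (-(m : ℝ) - 1 + α))) := by
  set τ := glueScale β α a b q with hτ
  set X := τ * amp β a b (q + 1) * mollScale β α a b q ^ (-(m : ℝ) - 1 + α) with hX
  have hX0 : 0 ≤ X := by
    have h1 := h.hτ
    have h2 := amp_pos (β := β) (b := b) ha (q + 1)
    have h3 := mollScale_pos (β := β) (α := α) (b := b) ha q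
    positivity
  have hti : t ∈ glueInterval T τ i := (h.Icc_subset_glueInterval hi).1 ht
  have hti' : t ∈ glueInterval T τ (i + 1) := (h.Icc_subset_glueInterval hi).2 ht
  have htT : t ∈ Icc 0 T := glueInterval_subset_Icc T τ i hti
  have hmono : ENNReal.ofReal (C₃ * X) ≤ ENNReal.ofReal (|C₃| * X) :=
    ENNReal.ofReal_le_ofReal (mul_le_mul_of_nonneg_right (le_abs_self _) hX0)
  have hf := ((hS i hi.le).velocity_sub m hm t hti).trans hmono
  have hg := ((hS (i + 1) (Nat.succ_le_of_lt hi)).velocity_sub m hm t hti').trans hmono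
  have hvℓ := h.isSmooth_vℓ htT
  have hfs : IsContDiff m (fun x => v i t x - vℓ t x) :=
    ((h.isSmooth_v hi.le hti).sub hvℓ).isContDiff (mod_cast le_top)
  have hgs : IsContDiff m (fun x => v (i + 1) t x - vℓ t x) :=
    ((h.isSmooth_v (Nat.succ_le_of_lt hi) hti').sub hvℓ).isContDiff (mod_cast le_top)
  rw [velDiff_eq_sub_sub v vℓ i t]
  calc Torus.eContDiffHolderNorm m (Real.toNNReal α) ((fun x => v i t x - vℓ t x) - fun x => v (i + 1) t x - vℓ t x)
      ≤ Torus.eContDiffHolderNorm m (Real.toNNReal α) (fun x => v i t x - vℓ t x) +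
          Torus.eContDiffHolderNorm m (Real.toNNReal α) (fun x => v (i + 1) t x - vℓ t x) :=
        Torus.eContDiffHolderNorm_sub_le hfs hgs
    _ ≤ ENNReal.ofReal (|C₃| * X) + ENNReal.ofReal (|C₃| * X) := add_le_add hf hg
    _ = ENNReal.ofReal (2 * |C₃| * X) := by
        rw [← ENNReal.ofReal_add (by positivity) (by positivity)]; ring_nf

/-- **(3.17) for the potentials**: `‖ℬ w_i(t)‖_{m+α} ≤ |C₃| τ_q δ_{q+1} ℓ^{-m+α}` on `[tᵢ, tᵢ + τ]`,
`i < n`, `m ≤ N̄` (Prop. 3.4). [cite: BuckmasterEtAl2018, Prop. 3.4 (3.17)] -/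
theorem IsGlueFamily.eContDiffHolderNorm_biotSavart_velDiff_le (h : IsGlueFamily T (glueScale β α a b q) n vℓ pℓ Rℓ v p)
    (hP : ∀ i : ℕ, i < n → PotentialBounds β α a b T C₃ q Nb i vℓ (v i) (v (i + 1))) (ha : 1 ≤ a)
    {i : ℕ} (hi : i < n) {t : ℝ} (ht : t ∈ Icc ((i : ℝ) * glueScale β α a b q) ((i : ℝ) * glueScale β α a b q + glueScale β α a b q))
    {m : ℕ} (hm : m ≤ Nb) :
    Torus.eContDiffHolderNorm m (Real.toNNReal α) (biotSavart (velDiff v i t)) ≤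
      ENNReal.ofReal (|C₃| * (glueScale β α a b q * amp β a b (q + 1) * mollScale β α a b q ^ (-(m : ℝ) + α))) := by
  set τ := glueScale β α a b q with hτ
  set X := τ * amp β a b (q + 1) * mollScale β α a b q ^ (-(m : ℝ) + α) with hX
  have hX0 : 0 ≤ X := by
    have h1 := h.hτ
    have h2 := amp_pos (β := β) (b := b) ha (q + 1)
    have h3 := mollScale_pos (β := β) (α := α) (b := b) ha q
    positivity
  have hmem : t ∈ glueInterval T τ i ∩ glueInterval T τ (i + 1) := by
    rw [h.glueInterval_inter_succ hi]; exact ht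
  have hb := (hP i hi).potential m hm t hmem
  exact hb.trans (ENNReal.ofReal_le_ofReal (mul_le_mul_of_nonneg_right (le_abs_self _) hX0))

/-- **"`ℛ curl` is a zero-order operator"** applied to the glued stress: with a Calderón–Zygmund
constant `C_cz` for `ℛ ∘ curl` at order `N` (`BDSV.holderCZBound.antidivergence_curl_le`),
`‖ℛ w_i(t)‖_{N+α} ≤ C_cz |C₃| τ_q δ_{q+1} ℓ^{-N+α}` on `[tᵢ, tᵢ + τ]` (`w_i = curl ℬw_i` and (3.17)).
[cite: BuckmasterEtAl2018, §4.4 (proof of Prop. 4.3)] -/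
theorem IsGlueFamily.eContDiffHolderNorm_antidivergence_velDiff_le (h : IsGlueFamily T (glueScale β α a b q) n vℓ pℓ Rℓ v p)
    (hP : ∀ i : ℕ, i < n → PotentialBounds β α a b T C₃ q Nb i vℓ (v i) (v (i + 1))) (ha : 1 ≤ a)
    {N : ℕ} {Ccz : ℝ≥0∞}
    (hcz : ∀ z : UnitAddTorus (Fin 3) → EuclideanSpace ℝ (Fin 3), IsSmooth z → Torus.eContDiffHolderNorm N (Real.toNNReal α) (fun x => Torus.antidivergence (curl z) x) ≤
      Ccz * Torus.eContDiffHolderNorm N (Real.toNNReal α) z)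
    {i : ℕ} (hi : i < n) {t : ℝ} (ht : t ∈ Icc ((i : ℝ) * glueScale β α a b q) ((i : ℝ) * glueScale β α a b q + glueScale β α a b q))
    (hN : N ≤ Nb) :
    Torus.eContDiffHolderNorm N (Real.toNNReal α) (fun x => Torus.antidivergence (velDiff v i t) x) ≤
      Ccz * ENNReal.ofReal (|C₃| * (glueScale β α a b q * amp β a b (q + 1) * mollScale β α a b q ^ (-(N : ℝ) + α))) := by
  set z := biotSavart (velDiff v i t) with hz
  have hzs : IsSmooth z := isSmooth_biotSavart (h.isSmooth_velDiff hi ht)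
  have e : (fun x => Torus.antidivergence (velDiff v i t) x) = fun x => Torus.antidivergence (curl z) x := by
    rw [hz, h.curl_biotSavart_velDiff hi ht]
  rw [e]
  exact (hcz z hzs).trans (mul_le_mul' le_rfl (h.eContDiffHolderNorm_biotSavart_velDiff_le hP ha hi ht hN))

variable {B : EuclideanSpace ℝ (Fin 3) →L[ℝ] EuclideanSpace ℝ (Fin 3) →L[ℝ] (Fin 3 → EuclideanSpace ℝ (Fin 3))}

/-- **The transition term**: `‖w_i(t) ⊗̊ w_i(t)‖_{N+α} ≤ 3ᴺ‖B‖(N+1) · 4C₃² τ_q² δ_{q+1}² ℓ^{-N-2+2α}` on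
`[tᵢ, tᵢ + τ]`, `i < n`, `N ≤ N̄` (Leibniz and (3.12): BDSV's
"`‖vᵢ - vᵢ₊₁‖_{N+α}‖vᵢ - vᵢ₊₁‖_α ≲ τ_q²δ_{q+1}²ℓ^{-2-N+2α}`"). [cite: BuckmasterEtAl2018, §4.4 (proof of Prop. 4.3)] -/
theorem IsGlueFamily.eContDiffHolderNorm_tracelessSq_velDiff_le
    (hB : ∀ (a b : EuclideanSpace ℝ (Fin 3)) (j : Fin 3), B a b j = a j • b - (inner ℝ a b / 3) • EuclideanSpace.single j (1 : ℝ))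
    (h : IsGlueFamily T (glueScale β α a b q) n vℓ pℓ Rℓ v p)
    (hS : ∀ i : ℕ, i ≤ n → StabilityBounds β α a b T C₃ q Nb i vℓ pℓ (v i) (p i)) (ha : 1 ≤ a)
    {i : ℕ} (hi : i < n) {t : ℝ} (ht : t ∈ Icc ((i : ℝ) * glueScale β α a b q) ((i : ℝ) * glueScale β α a b q + glueScale β α a b q))
    {N : ℕ} (hN : N ≤ Nb) :
    Torus.eContDiffHolderNorm N (Real.toNNReal α) (Torus.tracelessSq (velDiff v i t)) ≤
      3 ^ N * ‖B‖ₑ * ((N + 1 : ℕ) * ENNReal.ofReal (4 * C₃ ^ 2 *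
        (glueScale β α a b q ^ 2 * amp β a b (q + 1) ^ 2 * mollScale β α a b q ^ (-(N : ℝ) - 2 + 2 * α)))) := by
  set τ := glueScale β α a b q with hτ
  set δ := amp β a b (q + 1) with hδ
  set ℓ := mollScale β α a b q with hℓdef
  have hℓ : 0 < ℓ := mollScale_pos ha q
  have hτ0 : 0 < τ := h.hτ
  have hδ0 : 0 < δ := amp_pos ha (q + 1)
  have hw := h.isSmooth_velDiff hi ht
  refine (eContDiffHolderNorm_tracelessSq_le hB hw N (Real.toNNReal α)).trans (mul_le_mul' le_rfl ?_)
  -- each summand is bounded by the same quantity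
  have hterm : ∀ j ∈ Finset.range (N + 1),
      Torus.eContDiffHolderNorm j (Real.toNNReal α) (velDiff v i t) * Torus.eContDiffHolderNorm (N - j) (Real.toNNReal α) (velDiff v i t) ≤
        ENNReal.ofReal (4 * C₃ ^ 2 * (τ ^ 2 * δ ^ 2 * ℓ ^ (-(N : ℝ) - 2 + 2 * α))) := by
    intro j hj
    have hjN : j ≤ N := Nat.lt_succ_iff.1 (Finset.mem_range.1 hj)
    have h1 := h.eContDiffHolderNorm_velDiff_le hS ha hi ht (hjN.trans hN)
    have h2 := h.eContDiffHolderNorm_velDiff_le hS ha hi ht (m := N - j) ((Nat.sub_le N j).trans hN)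
    refine (mul_le_mul' h1 h2).trans ?_
    rw [← ENNReal.ofReal_mul (by positivity)]
    refine ENNReal.ofReal_le_ofReal (le_of_eq ?_)
    have e : ℓ ^ (-(j : ℝ) - 1 + α) * ℓ ^ (-((N - j : ℕ) : ℝ) - 1 + α) = ℓ ^ (-(N : ℝ) - 2 + 2 * α) := by
      rw [← Real.rpow_add hℓ, Nat.cast_sub hjN]; congr 1; ring
    calc 2 * |C₃| * (τ * δ * ℓ ^ (-(j : ℝ) - 1 + α)) * (2 * |C₃| * (τ * δ * ℓ ^ (-((N - j : ℕ) : ℝ) - 1 + α)))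
        = 4 * (|C₃| * |C₃|) * (τ ^ 2 * δ ^ 2 * (ℓ ^ (-(j : ℝ) - 1 + α) * ℓ ^ (-((N - j : ℕ) : ℝ) - 1 + α))) := by ring
      _ = 4 * C₃ ^ 2 * (τ ^ 2 * δ ^ 2 * ℓ ^ (-(N : ℝ) - 2 + 2 * α)) := by rw [e, ← sq, sq_abs]
  calc ∑ j ∈ Finset.range (N + 1), Torus.eContDiffHolderNorm j (Real.toNNReal α) (velDiff v i t) *
        Torus.eContDiffHolderNorm (N - j) (Real.toNNReal α) (velDiff v i t)
      ≤ ∑ _j ∈ Finset.range (N + 1), ENNReal.ofReal (4 * C₃ ^ 2 * (τ ^ 2 * δ ^ 2 * ℓ ^ (-(N : ℝ) - 2 + 2 * α))) :=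
        Finset.sum_le_sum hterm
    _ = ((N + 1 : ℕ) : ℝ≥0∞) * ENNReal.ofReal (4 * C₃ ^ 2 * (τ ^ 2 * δ ^ 2 * ℓ ^ (-(N : ℝ) - 2 + 2 * α))) := by
        rw [Finset.sum_const, Finset.card_range, nsmul_eq_mul]

/-- The glued stress at a time of `[tᵢ, tᵢ + τ]` as a combination of the two fields `ℛ w_i`,
`w_i ⊗̊ w_i` (the column-wise formula `gluedStress_apply`, as an identity of matrix fields). [cite: BuckmasterEtAl2018, §4.2] -/
theorem IsGlueFamily.gluedStress_eq {τ : ℝ} (h : IsGlueFamily T τ n vℓ pℓ Rℓ v p) {i : ℕ} {t : ℝ}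
    (ht : t ∈ Icc ((i : ℝ) * τ) ((i : ℝ) * τ + τ)) :
    gluedStress τ n v t = if i < n then
      stepDeriv τ n i t • (fun x => Torus.antidivergence (velDiff v i t) x) -
        stepWeight τ n i t • Torus.tracelessSq (velDiff v i t) else 0 := by
  funext x j
  rw [h.gluedStress_apply ht x j]
  split_ifs with hi
  · simp [Pi.smul_apply, Pi.sub_apply]
  · rfl

/-- **Prop. 4.3, (4.7) = (2.20), at a fixed time**: for `t ∈ [0,T]`,
`‖R̊̄_q(t)‖_{N+α} ≤ (E₁ C_cz |C₃| + 3ᴺ‖B‖(N+1)4C₃²) δ_{q+1} ℓ^{-N+α}`, where `C_cz` is a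
Calderón–Zygmund constant for `ℛ ∘ curl` at order `N` and `E₁ = stepProfileBound 1`
(BDSV: "`‖R̊̄_q‖_{N+α} ≲ τ_q⁻¹‖zᵢ - zᵢ₊₁‖_{N+α} + ‖vᵢ - vᵢ₊₁‖_{N+α}‖vᵢ - vᵢ₊₁‖_α ≲ δ_{q+1}ℓ^{-N+α} + τ_q²δ_{q+1}²ℓ^{-2-N+2α} ≲ δ_{q+1}ℓ^{-N+α}`").
[cite: BuckmasterEtAl2018, Prop. 4.3 (4.7)] -/
theorem IsGlueFamily.eContDiffHolderNorm_gluedStress_le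
    (hB : ∀ (a b : EuclideanSpace ℝ (Fin 3)) (j : Fin 3), B a b j = a j • b - (inner ℝ a b / 3) • EuclideanSpace.single j (1 : ℝ))
    (h : IsGlueFamily T (glueScale β α a b q) n vℓ pℓ Rℓ v p)
    (hS : ∀ i : ℕ, i ≤ n → StabilityBounds β α a b T C₃ q Nb i vℓ pℓ (v i) (p i))
    (hP : ∀ i : ℕ, i < n → PotentialBounds β α a b T C₃ q Nb i vℓ (v i) (v (i + 1)))
    (ha : 1 ≤ a) (hb : 1 ≤ b) (hβ : 0 ≤ β) (hα : 0 ≤ α) {N : ℕ} (hN : N ≤ Nb) {Ccz : ℝ≥0∞}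
    (hcz : ∀ z : UnitAddTorus (Fin 3) → EuclideanSpace ℝ (Fin 3), IsSmooth z → Torus.eContDiffHolderNorm N (Real.toNNReal α) (fun x => Torus.antidivergence (curl z) x) ≤
      Ccz * Torus.eContDiffHolderNorm N (Real.toNNReal α) z)
    {t : ℝ} (htT : t ∈ Icc 0 T) :
    Torus.eContDiffHolderNorm N (Real.toNNReal α) (gluedStress (glueScale β α a b q) n v t) ≤
      (ENNReal.ofReal (stepProfileBound 1 * |C₃|) * Ccz + 3 ^ N * ‖B‖ₑ * ((N + 1 : ℕ) * ENNReal.ofReal (4 * C₃ ^ 2))) *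
        ENNReal.ofReal (amp β a b (q + 1) * mollScale β α a b q ^ (-(N : ℝ) + α)) := by
  set τ := glueScale β α a b q with hτdef
  set δ := amp β a b (q + 1) with hδ
  set ℓ := mollScale β α a b q with hℓdef
  have hℓ : 0 < ℓ := mollScale_pos ha q
  have hτ : 0 < τ := h.hτ
  have hδ0 : 0 < δ := amp_pos ha (q + 1)
  set Y := δ * ℓ ^ (-(N : ℝ) + α) with hY
  have hY0 : 0 ≤ Y := by positivity
  obtain ⟨i, hin, hti⟩ := h.exists_anchor htT
  rw [h.gluedStress_eq hti]
  rcases lt_or_eq_of_le hin with hi | rfl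
  · rw [if_pos hi]
    have hw := h.isSmooth_velDiff hi hti
    have hAs : IsContDiff N (fun x => Torus.antidivergence (velDiff v i t) x) :=
      (Torus.isSmooth_antidivergence hw).isContDiff (mod_cast le_top)
    have hQs : IsContDiff N (Torus.tracelessSq (velDiff v i t)) := hw.tracelessSq.isContDiff (mod_cast le_top)
    -- the two terms
    have hA := h.eContDiffHolderNorm_antidivergence_velDiff_le hP ha hcz hi hti hN
    have hQ := h.eContDiffHolderNorm_tracelessSq_velDiff_le hB hS ha hi hti hN
    have hθ' : ‖stepDeriv τ n i t‖ₑ ≤ ENNReal.ofReal (stepProfileBound 1 * τ⁻¹) := by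
      rw [← Real.enorm_abs, Real.enorm_eq_ofReal (abs_nonneg _)]
      exact ENNReal.ofReal_le_ofReal (abs_stepDeriv_le hτ n i t)
    have hww : ‖stepWeight τ n i t‖ₑ ≤ 1 := by
      rw [← Real.enorm_abs, Real.enorm_eq_ofReal (abs_nonneg _), ← ENNReal.ofReal_one]
      exact ENNReal.ofReal_le_ofReal (abs_stepWeight_le_one τ n i t)
    -- first term: `E₁ τ⁻¹ · Ccz |C₃| τ δ ℓ^{-N+α} = E₁ |C₃| Ccz · Y`
    have h1 : ‖stepDeriv τ n i t‖ₑ * Torus.eContDiffHolderNorm N (Real.toNNReal α) (fun x => Torus.antidivergence (velDiff v i t) x) ≤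
        ENNReal.ofReal (stepProfileBound 1 * |C₃|) * Ccz * ENNReal.ofReal Y := by
      calc ‖stepDeriv τ n i t‖ₑ * Torus.eContDiffHolderNorm N (Real.toNNReal α) (fun x => Torus.antidivergence (velDiff v i t) x)
          ≤ ENNReal.ofReal (stepProfileBound 1 * τ⁻¹) * (Ccz * ENNReal.ofReal (|C₃| * (τ * δ * ℓ ^ (-(N : ℝ) + α)))) :=
            mul_le_mul' hθ' hA
        _ = Ccz * (ENNReal.ofReal (stepProfileBound 1 * τ⁻¹) * ENNReal.ofReal (|C₃| * (τ * δ * ℓ ^ (-(N : ℝ) + α)))) := by ring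
        _ = Ccz * ENNReal.ofReal (stepProfileBound 1 * |C₃| * Y) := by
            rw [← ENNReal.ofReal_mul (mul_nonneg (stepProfileBound_nonneg 1) (inv_nonneg.2 hτ.le))]
            congr 1; congr 1
            field_simp
            ring
        _ = ENNReal.ofReal (stepProfileBound 1 * |C₃|) * Ccz * ENNReal.ofReal Y := by
            rw [ENNReal.ofReal_mul (mul_nonneg (stepProfileBound_nonneg 1) (abs_nonneg _))]; ring
    -- second term: `1 · 3^N ‖B‖ (N+1) 4C₃² τ²δ²ℓ^{-N-2+2α} ≤ 3^N ‖B‖ (N+1) 4C₃² · Y`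
    have hpar : τ ^ 2 * δ ^ 2 * ℓ ^ (-(N : ℝ) - 2 + 2 * α) ≤ Y :=
      glueScale_sq_mul_amp_succ_sq_mul_rpow_le ha hb hβ hα q N
    have h2 : ‖stepWeight τ n i t‖ₑ * Torus.eContDiffHolderNorm N (Real.toNNReal α) (Torus.tracelessSq (velDiff v i t)) ≤
        3 ^ N * ‖B‖ₑ * ((N + 1 : ℕ) * ENNReal.ofReal (4 * C₃ ^ 2)) * ENNReal.ofReal Y := by
      calc ‖stepWeight τ n i t‖ₑ * Torus.eContDiffHolderNorm N (Real.toNNReal α) (Torus.tracelessSq (velDiff v i t))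
          ≤ 1 * (3 ^ N * ‖B‖ₑ * ((N + 1 : ℕ) * ENNReal.ofReal (4 * C₃ ^ 2 * (τ ^ 2 * δ ^ 2 * ℓ ^ (-(N : ℝ) - 2 + 2 * α))))) :=
            mul_le_mul' hww hQ
        _ ≤ 1 * (3 ^ N * ‖B‖ₑ * ((N + 1 : ℕ) * ENNReal.ofReal (4 * C₃ ^ 2 * Y))) := by
            gcongr
        _ = 3 ^ N * ‖B‖ₑ * ((N + 1 : ℕ) * ENNReal.ofReal (4 * C₃ ^ 2)) * ENNReal.ofReal Y := by
            rw [ENNReal.ofReal_mul (by positivity)]; ring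
    calc Torus.eContDiffHolderNorm N (Real.toNNReal α)
          (stepDeriv τ n i t • (fun x => Torus.antidivergence (velDiff v i t) x) - stepWeight τ n i t • Torus.tracelessSq (velDiff v i t))
        ≤ Torus.eContDiffHolderNorm N (Real.toNNReal α) (stepDeriv τ n i t • fun x => Torus.antidivergence (velDiff v i t) x) +
            Torus.eContDiffHolderNorm N (Real.toNNReal α) (stepWeight τ n i t • Torus.tracelessSq (velDiff v i t)) :=
          Torus.eContDiffHolderNorm_sub_le (hAs.smul _) (hQs.smul _)
      _ = ‖stepDeriv τ n i t‖ₑ * Torus.eContDiffHolderNorm N (Real.toNNReal α) (fun x => Torus.antidivergence (velDiff v i t) x) +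
            ‖stepWeight τ n i t‖ₑ * Torus.eContDiffHolderNorm N (Real.toNNReal α) (Torus.tracelessSq (velDiff v i t)) := by
          rw [Torus.eContDiffHolderNorm_const_smul hAs, Torus.eContDiffHolderNorm_const_smul hQs]
      _ ≤ ENNReal.ofReal (stepProfileBound 1 * |C₃|) * Ccz * ENNReal.ofReal Y +
            3 ^ N * ‖B‖ₑ * ((N + 1 : ℕ) * ENNReal.ofReal (4 * C₃ ^ 2)) * ENNReal.ofReal Y := add_le_add h1 h2
      _ = _ := by rw [hY]; ring
  · rw [if_neg (lt_irrefl _), Torus.eContDiffHolderNorm_zero_fun]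
    exact bot_le

/-- The constant of (2.20) is finite when the Calderón–Zygmund constant is. [folklore] -/
theorem stressSizeConst_ne_top (B : EuclideanSpace ℝ (Fin 3) →L[ℝ] EuclideanSpace ℝ (Fin 3) →L[ℝ] (Fin 3 → EuclideanSpace ℝ (Fin 3))) (C₃ : ℝ) {Ccz : ℝ≥0∞} (hCcz : Ccz ≠ ⊤) (N : ℕ) :
    ENNReal.ofReal (stepProfileBound 1 * |C₃|) * Ccz + 3 ^ N * ‖B‖ₑ * ((N + 1 : ℕ) * ENNReal.ofReal (4 * C₃ ^ 2)) ≠ ⊤ := by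
  refine ENNReal.add_ne_top.2 ⟨ENNReal.mul_ne_top ENNReal.ofReal_ne_top hCcz, ?_⟩
  refine ENNReal.mul_ne_top (ENNReal.mul_ne_top (ENNReal.pow_ne_top (by norm_num)) enorm_ne_top) ?_
  exact ENNReal.mul_ne_top (ENNReal.natCast_ne_top _) ENNReal.ofReal_ne_top

/-- A finite `ℝ≥0∞` constant times `ofReal Y` is `ofReal` of the real product. [folklore] -/
theorem mul_ofReal_eq_ofReal_toReal_mul {K : ℝ≥0∞} (hK : K ≠ ⊤) (Y : ℝ) :
    K * ENNReal.ofReal Y = ENNReal.ofReal (K.toReal * Y) := by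
  rw [ENNReal.ofReal_mul ENNReal.toReal_nonneg, ENNReal.ofReal_toReal hK]

/-- **Prop. 4.3, (4.7) = (2.20)**: `‖R̊̄_q‖_{N+α} ≤ K_N δ_{q+1} ℓ^{-N+α}` on `[0,T]` for `N ≤ N̄`, with
the real constant `K_N = (E₁ C_cz |C₃| + 3ᴺ‖B‖(N+1)4C₃²)` (finite Calderón–Zygmund constant `C_cz`
for `ℛ ∘ curl` at order `N`). [cite: BuckmasterEtAl2018, Prop. 4.3 (4.7) and §2.5 (2.20)] -/
theorem IsGlueFamily.holderSupLE_gluedStress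
    (hB : ∀ (a b : EuclideanSpace ℝ (Fin 3)) (j : Fin 3), B a b j = a j • b - (inner ℝ a b / 3) • EuclideanSpace.single j (1 : ℝ))
    (h : IsGlueFamily T (glueScale β α a b q) n vℓ pℓ Rℓ v p)
    (hS : ∀ i : ℕ, i ≤ n → StabilityBounds β α a b T C₃ q Nb i vℓ pℓ (v i) (p i))
    (hP : ∀ i : ℕ, i < n → PotentialBounds β α a b T C₃ q Nb i vℓ (v i) (v (i + 1)))
    (ha : 1 ≤ a) (hb : 1 ≤ b) (hβ : 0 ≤ β) (hα : 0 ≤ α) {N : ℕ} (hN : N ≤ Nb) {Ccz : ℝ≥0∞} (hCcz : Ccz ≠ ⊤)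
    (hcz : ∀ z : UnitAddTorus (Fin 3) → EuclideanSpace ℝ (Fin 3), IsSmooth z → Torus.eContDiffHolderNorm N (Real.toNNReal α) (fun x => Torus.antidivergence (curl z) x) ≤
      Ccz * Torus.eContDiffHolderNorm N (Real.toNNReal α) z) :
    HolderSupLE T (gluedStress (glueScale β α a b q) n v) N (Real.toNNReal α)
      ((ENNReal.ofReal (stepProfileBound 1 * |C₃|) * Ccz + 3 ^ N * ‖B‖ₑ * ((N + 1 : ℕ) * ENNReal.ofReal (4 * C₃ ^ 2))).toReal *
        (amp β a b (q + 1) * mollScale β α a b q ^ (-(N : ℝ) + α))) := by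
  intro t htT
  rw [← mul_ofReal_eq_ofReal_toReal_mul (stressSizeConst_ne_top B C₃ hCcz N)]
  exact h.eContDiffHolderNorm_gluedStress_le hB hS hP ha hb hβ hα hN hcz htT

end Stress

end BDSV

end Literature.Analysis.FluidPDE
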